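import Literature.AlgebraicGeometry.Motives.ComplexAutGaloisDescent
import Literature.AlgebraicGeometry.AbelianSchemes.RingActionOfPointwiseIdentities
import Literature.AlgebraicGeometry.AbelianSchemes.AbelianSchemeOverHomNoetherianAnyBase
import Literature.AlgebraicGeometry.AbelianSchemes.AbelianSchemeOverLevelBaseChange
import HarnessLib

/-!
# Descent of a complex endomorphism of an abelian scheme over a `K`-scheme, `Aut(ℂ/K)`-equivariance checked on ONE fibre
# per connected component ([Milne2005ShimuraVarieties] Prop. 13.1; [MumfordFogartyKirwan1994] Ch. 6 §1 Cor. 6.2 ∕ 6.4)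

Layer `Literature/AlgebraicGeometry/AbelianSchemes`, namespace `Literature.AlgebraicGeometry.AbelianSchemes.AbelianSchemeOver`.
THEOREMS ONLY (no definition, no named fact, no instance, no notation, no `sorry`); universe `0` (that of `ℂ` in ★
`Motives/ComplexAutGaloisDescent`).  Cell `hodgecm-mathlib` (D-0151), FLOOR 0, P6 «MOD» (crux hLiu418 = stmt-HodgeConjecture-24832,
`--supports`), E-line `Cruxes/HLiu418/Lines/F0_P6a_PELWitnessE.lean`, organ E6 `UnitaryCurvePELTuple`, brick (B-γ) of A-p06 (g32)'s census
`CENSUS-E6-UnitaryCurvePELTuple.v1` §4 («rigidity descent to `Fᵢ`» of `stub_E6`: the `𝒪_F`-action is produced over `ℂ`; it descends to the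
slice field once its Galois conjugates agree with it at ONE CM point per connected component).  HC_CM is proved only modulo the printed
citations until rung 0 closes; this file is generic and changes no count.

THE MATHEMATICS.  `K ⊆ ℂ` countable, `T` a separated `K`-scheme, `A → T` an abelian scheme, `A_ℂ := A ×_T T_ℂ → T_ℂ` (`T_ℂ := T ×_K ℂ`,
★ `GaloisDescent.bc`).  `Aut(ℂ/K)` acts on `T_ℂ` (★ `GaloisDescent.gal`) and on `A ×_T T_ℂ` through the second factor — «`galA σ`», a letter BY
VALUE: any maps with `galA σ ≫ pr_A = pr_A`, `galA σ ≫ pr_{T_ℂ} = pr_{T_ℂ} ≫ gal σ` (the canonical `pullback.map … (𝟙 A) (gal σ) (𝟙 T) …`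
satisfies them, §1).  For a HOMOMORPHISM `r : A_ℂ → A_ℂ` over `T_ℂ`:
(1) ([Milne2005ShimuraVarieties] Prop. 13.1 = ★ `GaloisDescent.existsUnique_map_eq_complex` on the TOTAL SPACE `A → Spec K`, whose
complexification `≅ A ×_T T_ℂ` (Mathlib `pullbackRightPullbackFstIso`) is assumed reduced) if `galA σ ∘ r = r ∘ galA σ` for all `σ`, then
`r = e ×_T T_ℂ` for a UNIQUE `T`-endomorphism `e`, a homomorphism when `T` is locally Noetherian (unit compatibility through the faithfully
flat `T_ℂ → T`); (2) ([MumfordFogartyKirwan1994] Ch. 6 §1 Cor. 6.2 ∕ 6.4, RIGIDITY) `r ∘ galA σ` and `galA σ ∘ r` cover `gal σ`, i.e. they are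
two HOMOMORPHISMS `A_ℂ ⇉ (gal σ)^* A_ℂ` over `T_ℂ`, so (★ (B-α) `eq_of_forall_exists_fieldPoint`) they agree as soon as they agree on the fibre
over ONE field-valued point in every connected component of `T_ℂ`.  Together (§4): **an endomorphism of `A_ℂ/T_ℂ` whose `Aut(ℂ/K)`-conjugates
agree with it on one fibre per connected component is defined over `K`** ([Milne2005ShimuraVarieties] Thm. 13.7 ∕ Rem. 13.8 pattern).
§1 plumbing (`pullback_map_left_comp_fst'∕snd'`, `pullback_map_eq_of_fst_comp_eq`, `pullback_map_injective_of_surjective_flat`,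
`pullbackMap_gal_fst_snd`, `one_baseChange_left_comp_galA`); §2 `gal_comp_eq_of_forall_exists_fieldPoint` (2); §3
`existsUnique_pullback_map_eq_of_forall_gal_comp` (1), `isMonHom_of_pullback_map_eq_bcSpec`; §4 THE HEAD
`existsUnique_hom_pullback_map_eq_of_forall_exists_fieldPoint` (+ `…_pullbackMap`).

## References
* [Milne2005ShimuraVarieties] J. S. Milne, *Introduction to Shimura Varieties* (2005∕2017), §13 Prop. 13.1 p. 117, Thm. 13.7 ∕ Rem. 13.8 p. 119.
* [MumfordFogartyKirwan1994] D. Mumford, J. Fogarty, F. Kirwan, *Geometric Invariant Theory*, 3rd ed. (1994), Ch. 6 §1 Cor. 6.2 (p. 116), 6.4 (p. 117).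
* [GortzWedhorn2020] U. Görtz, T. Wedhorn, *Algebraic Geometry I*, 2nd ed. (2020), Section (4.7), §(14.20), Thm. 14.72 (1).
-/

set_option autoImplicit false

noncomputable section

open CategoryTheory CategoryTheory.Limits AlgebraicGeometry MonoidalCategory CartesianMonoidalCategory TopologicalSpace Cardinal
open scoped MonObj
open Literature.AlgebraicGeometry.Motives (SchemeOver)
open Literature.AlgebraicGeometry.Motives.GaloisDescent (gal bc gal_fst gal_snd gal_fst_assoc gal_snd_assoc
  existsUnique_map_eq_complex)
open Literature.AlgebraicGeometry.Motives.AbelianVariety (bcSpec bcFunctor bcFunctor_map_injective specAut)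

namespace Literature.AlgebraicGeometry.AbelianSchemes

namespace AbelianSchemeOver

set_option backward.isDefEq.respectTransparency false

/-! ## §1 Plumbing -/

section OverPullback

variable {S S' : Scheme.{0}} {X Y : Over S}

/-- `(f ×_S S′) ≫ pr_Y = pr_X ≫ f` on underlying schemes (Mathlib `Over.pullback_map_left`). [cite: GortzWedhorn2020, Section (4.7)] -/
theorem pullback_map_left_comp_fst' (f : X ⟶ Y) (s : S' ⟶ S) :
    ((Over.pullback s).map f).left ≫ pullback.fst Y.hom s = pullback.fst X.hom s ≫ f.left := by
  simp only [Over.pullback_map_left, pullback.lift_fst]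

/-- `(f ×_S S′) ≫ pr_{S′} = pr_{S′}` on underlying schemes. [cite: GortzWedhorn2020, Section (4.7)] -/
theorem pullback_map_left_comp_snd' (f : X ⟶ Y) (s : S' ⟶ S) :
    ((Over.pullback s).map f).left ≫ pullback.snd Y.hom s = pullback.snd X.hom s := by
  simp only [Over.pullback_map_left, pullback.lift_snd]

/-- **Fibre agreement of underlying maps ⇒ agreement of base changes** (plumbing for ★ rigidity, which is phrased with `Over.pullback`):
for `S`-morphisms `f, g : X → Y` and `s : S′ → S`, if `pr ≫ f = pr ≫ g` on `X ×_S S′` then `f ×_S S′ = g ×_S S′`. [cite: GortzWedhorn2020, Section (4.7)] -/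
theorem pullback_map_eq_of_fst_comp_eq (f g : X ⟶ Y) (s : S' ⟶ S)
    (h : pullback.fst X.hom s ≫ f.left = pullback.fst X.hom s ≫ g.left) :
    (Over.pullback s).map f = (Over.pullback s).map g := by
  ext : 1
  apply pullback.hom_ext
  · rw [pullback_map_left_comp_fst', pullback_map_left_comp_fst', h]
  · rw [pullback_map_left_comp_snd', pullback_map_left_comp_snd']

/-- **`Over.pullback` along a surjective flat morphism is faithful** (its projection `X ×_S S′ → X` is an fpqc epimorphism).
[cite: GortzWedhorn2020, Thm. 14.72 (1)] -/
theorem pullback_map_injective_of_surjective_flat (s : S' ⟶ S) [Flat s] [Surjective s] {f g : X ⟶ Y}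
    (h : (Over.pullback s).map f = (Over.pullback s).map g) : f = g := by
  haveI : Flat (pullback.fst X.hom s) := MorphismProperty.pullback_fst _ _ inferInstance
  haveI : Surjective (pullback.fst X.hom s) := MorphismProperty.pullback_fst _ _ inferInstance
  haveI : Epi (pullback.fst X.hom s) := Flat.epi_of_flat_of_surjective _
  have h' := congrArg (fun φ => Over.Hom.left φ ≫ pullback.fst Y.hom s) h
  simp only [pullback_map_left_comp_fst'] at h'
  ext : 1
  exact (cancel_epi (pullback.fst X.hom s)).1 h'

end OverPullback

variable {K : Type} [Field K] [Algebra K ℂ] {T : SchemeOver K} (A : AbelianSchemeOver T.left)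
  (galA : (ℂ ≃ₐ[K] ℂ) →
    (pullback A.X.hom (pullback.fst T.hom (bcSpec K ℂ)) ⟶ pullback A.X.hom (pullback.fst T.hom (bcSpec K ℂ))))
  (hgal₁ : ∀ σ, galA σ ≫ pullback.fst A.X.hom (pullback.fst T.hom (bcSpec K ℂ)) =
    pullback.fst A.X.hom (pullback.fst T.hom (bcSpec K ℂ)))
  (hgal₂ : ∀ σ, galA σ ≫ pullback.snd A.X.hom (pullback.fst T.hom (bcSpec K ℂ)) =
    pullback.snd A.X.hom (pullback.fst T.hom (bcSpec K ℂ)) ≫ gal ℂ T σ)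
  (r : (A.baseChange (pullback.fst T.hom (bcSpec K ℂ))).X ⟶ (A.baseChange (pullback.fst T.hom (bcSpec K ℂ))).X)

section Plumbing

/-- The CANONICAL Galois automorphisms `1 ×_T gal σ` of `A ×_T T_ℂ` satisfy the two by-value clauses (so every theorem below applies to
them). [cite: GortzWedhorn2020, §(14.20) (14.20.1)] -/
theorem pullbackMap_gal_fst_snd (σ : ℂ ≃ₐ[K] ℂ) :
    pullback.map A.X.hom (pullback.fst T.hom (bcSpec K ℂ)) A.X.hom (pullback.fst T.hom (bcSpec K ℂ)) (𝟙 A.X.left)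
        (gal ℂ T σ) (𝟙 T.left) (by rw [Category.comp_id, Category.id_comp]) (by rw [Category.comp_id, gal_fst]) ≫
        pullback.fst A.X.hom (pullback.fst T.hom (bcSpec K ℂ)) = pullback.fst A.X.hom (pullback.fst T.hom (bcSpec K ℂ)) ∧
      pullback.map A.X.hom (pullback.fst T.hom (bcSpec K ℂ)) A.X.hom (pullback.fst T.hom (bcSpec K ℂ)) (𝟙 A.X.left)
        (gal ℂ T σ) (𝟙 T.left) (by rw [Category.comp_id, Category.id_comp]) (by rw [Category.comp_id, gal_fst]) ≫
        pullback.snd A.X.hom (pullback.fst T.hom (bcSpec K ℂ)) = pullback.snd A.X.hom (pullback.fst T.hom (bcSpec K ℂ)) ≫ gal ℂ T σ :=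
  ⟨(pullback.lift_fst _ _ _).trans (Category.comp_id _), pullback.lift_snd _ _ _⟩

include hgal₁ hgal₂ in
/-- **The unit section of `A_ℂ` is Galois-equivariant**: `η_{A_ℂ} ≫ galA σ = gal σ ≫ η_{A_ℂ}` (both composites have first component
`pr ≫ η_A` — ★ `one_baseChange_left_comp_fst` — and second component `gal σ`). [cite: GortzWedhorn2020, §(14.20) and Thm. 14.72 (1)] -/
theorem one_baseChange_left_comp_galA (σ : ℂ ≃ₐ[K] ℂ) :
    η[(A.baseChange (pullback.fst T.hom (bcSpec K ℂ))).X].left ≫ galA σ =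
      gal ℂ T σ ≫ η[(A.baseChange (pullback.fst T.hom (bcSpec K ℂ))).X].left := by
  have hunit : η[(A.baseChange (pullback.fst T.hom (bcSpec K ℂ))).X].left ≫
      pullback.snd A.X.hom (pullback.fst T.hom (bcSpec K ℂ)) = 𝟙 (pullback T.hom (bcSpec K ℂ)) :=
    (A.baseChange (pullback.fst T.hom (bcSpec K ℂ))).unit_left_comp_hom
  apply pullback.hom_ext
  · rw [Category.assoc, hgal₁, Category.assoc, one_baseChange_left_comp_fst, gal_fst_assoc]
  · rw [Category.assoc, hgal₂, reassoc_of% hunit, Category.assoc, hunit]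
    erw [Category.comp_id, Category.id_comp]

end Plumbing

/-! ## §2 Equivariance from ONE fibre per connected component (rigidity) -/

section Rigidity

variable [IsLocallyNoetherian (bc ℂ T)] [IsMonHom r]

include hgal₁ hgal₂ in
/-- **Galois conjugates which agree on one fibre per connected component agree** ([MumfordFogartyKirwan1994] Ch. 6 §1 Cor. 6.2 ∕ 6.4):
for a homomorphism `r : A_ℂ → A_ℂ` over the locally Noetherian `T_ℂ` and `σ ∈ Aut(ℂ/K)`, the maps `r ≫ galA σ` and `galA σ ≫ r` are two
homomorphisms `A_ℂ → (gal σ)^* A_ℂ` OVER `T_ℂ` (unit: §1); if they agree on the fibre over one field-valued point in every connected component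
of `T_ℂ`, they are equal (★ (B-α) `eq_of_forall_exists_fieldPoint`). [cite: MumfordFogartyKirwan1994, Ch. 6 §1 Corollary 6.2 (p. 116) and Corollary 6.4 (p. 117)] -/
theorem gal_comp_eq_of_forall_exists_fieldPoint (σ : ℂ ≃ₐ[K] ℂ)
    (h : ∀ x : ↥(bc ℂ T), ∃ (L : Type) (_ : Field L) (s : Spec (.of L) ⟶ bc ℂ T),
      s.base (IsLocalRing.closedPoint L) ∈ connectedComponent x ∧
        pullback.fst (pullback.snd A.X.hom (pullback.fst T.hom (bcSpec K ℂ))) s ≫ r.left ≫ galA σ =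
          pullback.fst (pullback.snd A.X.hom (pullback.fst T.hom (bcSpec K ℂ))) s ≫ galA σ ≫ r.left) :
    galA σ ≫ r.left = r.left ≫ galA σ := by
  -- the abelian scheme `A_ℂ` over `T_ℂ` and its twist `(gal σ)^* A_ℂ`
  let g₀ := pullback.fst T.hom (bcSpec K ℂ)
  let Ac : AbelianSchemeOver (bc ℂ T) := A.baseChange g₀
  let B : AbelianSchemeOver (bc ℂ T) := Ac.baseChange (gal ℂ T σ)
  have hr : r.left ≫ pullback.snd A.X.hom g₀ = pullback.snd A.X.hom g₀ := Over.w r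
  -- the two lifts `A_ℂ ⇉ (gal σ)^* A_ℂ` over `T_ℂ`
  have w₁ : (r.left ≫ galA σ) ≫ Ac.X.hom = Ac.X.hom ≫ gal ℂ T σ := by
    change (r.left ≫ galA σ) ≫ pullback.snd A.X.hom g₀ = pullback.snd A.X.hom g₀ ≫ gal ℂ T σ
    rw [Category.assoc, hgal₂, reassoc_of% hr]
  have w₂ : (galA σ ≫ r.left) ≫ Ac.X.hom = Ac.X.hom ≫ gal ℂ T σ := by
    change (galA σ ≫ r.left) ≫ pullback.snd A.X.hom g₀ = pullback.snd A.X.hom g₀ ≫ gal ℂ T σ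
    rw [Category.assoc, hr, hgal₂]
  let f₁ : Ac.X ⟶ B.X := Over.homMk (pullback.lift (r.left ≫ galA σ) Ac.X.hom w₁) (pullback.lift_snd _ _ _)
  let f₂ : Ac.X ⟶ B.X := Over.homMk (pullback.lift (galA σ ≫ r.left) Ac.X.hom w₂) (pullback.lift_snd _ _ _)
  have hf₁ : f₁.left = pullback.lift (r.left ≫ galA σ) Ac.X.hom w₁ := rfl
  have hf₂ : f₂.left = pullback.lift (galA σ ≫ r.left) Ac.X.hom w₂ := rfl
  -- both preserve the unit section, hence are homomorphisms
  have hη : η[Ac.X].left ≫ galA σ = gal ℂ T σ ≫ η[Ac.X].left := A.one_baseChange_left_comp_galA galA hgal₁ hgal₂ σ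
  have hηr : η[Ac.X].left ≫ r.left = η[Ac.X].left := by rw [← Over.comp_left, IsMonHom.one_hom]
  have hηB : η[B.X].left ≫ pullback.fst Ac.X.hom (gal ℂ T σ) = gal ℂ T σ ≫ η[Ac.X].left :=
    Ac.one_baseChange_left_comp_fst (gal ℂ T σ)
  have hunitB : η[B.X].left ≫ pullback.snd Ac.X.hom (gal ℂ T σ) = 𝟙 (pullback T.hom (bcSpec K ℂ)) :=
    B.unit_left_comp_hom
  have hunitA : η[Ac.X].left ≫ Ac.X.hom = 𝟙 (pullback T.hom (bcSpec K ℂ)) := Ac.unit_left_comp_hom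
  haveI : IsMonHom f₁ := by
    refine isMonHom_of_one_comp_of_isLocallyNoetherian_base (A := Ac) (B := B) f₁ ?_
    ext : 1
    rw [Over.comp_left, hf₁]
    apply pullback.hom_ext
    · rw [Category.assoc, pullback.lift_fst, reassoc_of% hηr, hη, hηB]
    · rw [Category.assoc, pullback.lift_snd, hunitA, hunitB]
  haveI : IsMonHom f₂ := by
    refine isMonHom_of_one_comp_of_isLocallyNoetherian_base (A := Ac) (B := B) f₂ ?_
    ext : 1
    rw [Over.comp_left, hf₂]
    apply pullback.hom_ext
    · rw [Category.assoc, pullback.lift_fst, reassoc_of% hη, hηr, hηB]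
    · rw [Category.assoc, pullback.lift_snd, hunitA, hunitB]
  -- rigidity: they agree on one fibre per connected component
  have hfg : f₁ = f₂ := by
    refine eq_of_forall_exists_fieldPoint f₁ f₂ fun x => ?_
    obtain ⟨L, hL, s, hs, hfib⟩ := h x
    refine ⟨L, hL, s, hs, pullback_map_eq_of_fst_comp_eq f₁ f₂ s ?_⟩
    rw [hf₁, hf₂]
    apply pullback.hom_ext
    · rw [Category.assoc, pullback.lift_fst, Category.assoc, pullback.lift_fst]
      exact hfib
    · rw [Category.assoc, pullback.lift_snd, Category.assoc, pullback.lift_snd]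
  have key := congrArg (fun φ : Ac.X ⟶ B.X => φ.left ≫ pullback.fst Ac.X.hom (gal ℂ T σ)) hfg
  simp only [hf₁, hf₂, pullback.lift_fst] at key
  exact key.symm

include hgal₁ hgal₂ in
/-- **All `σ` at once**: if for every `σ ∈ Aut(ℂ/K)` and every connected component of `T_ℂ` some field-valued point of that component has
`r ∘ galA σ = galA σ ∘ r` on its fibre, then `galA σ ∘ r = r ∘ galA σ` for all `σ`. [cite: MumfordFogartyKirwan1994, Ch. 6 §1 Corollary 6.2 (p. 116) and Corollary 6.4 (p. 117)] -/
theorem forall_gal_comp_eq_of_forall_exists_fieldPoint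
    (h : ∀ (σ : ℂ ≃ₐ[K] ℂ) (x : ↥(bc ℂ T)), ∃ (L : Type) (_ : Field L) (s : Spec (.of L) ⟶ bc ℂ T),
      s.base (IsLocalRing.closedPoint L) ∈ connectedComponent x ∧
        pullback.fst (pullback.snd A.X.hom (pullback.fst T.hom (bcSpec K ℂ))) s ≫ r.left ≫ galA σ =
          pullback.fst (pullback.snd A.X.hom (pullback.fst T.hom (bcSpec K ℂ))) s ≫ galA σ ≫ r.left) :
    ∀ σ : ℂ ≃ₐ[K] ℂ, galA σ ≫ r.left = r.left ≫ galA σ :=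
  fun σ => A.gal_comp_eq_of_forall_exists_fieldPoint galA hgal₁ hgal₂ r σ (h σ)

end Rigidity

/-! ## §3 Descent of an equivariant endomorphism ([Milne2005ShimuraVarieties] Prop. 13.1 on the total space) -/

section Descent

variable (hK : #K ≤ ℵ₀) [IsSeparated T.hom] [IsReduced (pullback A.X.hom (pullback.fst T.hom (bcSpec K ℂ)))]

include hK hgal₁ hgal₂ in
/-- **DESCENT OF AN `Aut(ℂ/K)`-EQUIVARIANT ENDOMORPHISM of `A_ℂ/T_ℂ`** ([Milne2005ShimuraVarieties] Prop. 13.1, through the tree's ★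
`GaloisDescent.existsUnique_map_eq_complex` applied to the TOTAL SPACE `𝔄 := (A → T → Spec K)`, whose complexification `𝔄_ℂ ≅ A ×_T T_ℂ` is reduced
by hypothesis and which is separated over `K`): for `K ⊆ ℂ` countable, if `galA σ ∘ r = r ∘ galA σ` for all `σ`, then `r = e ×_T T_ℂ` for a
UNIQUE `T`-morphism `e : A → A`. [cite: Milne2005ShimuraVarieties, §13 Prop. 13.1 p. 117] [cite: GortzWedhorn2020, Thm. 14.72 (1)] -/
theorem existsUnique_pullback_map_eq_of_forall_gal_comp (hr : ∀ σ : ℂ ≃ₐ[K] ℂ, galA σ ≫ r.left = r.left ≫ galA σ) :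
    ∃! e : A.X ⟶ A.X, (Over.pullback (pullback.fst T.hom (bcSpec K ℂ))).map e = r := by
  haveI := A.isProper
  -- the total space as a `K`-scheme and its complexification
  let g₀ := pullback.fst T.hom (bcSpec K ℂ)
  let 𝔄 : SchemeOver K := Over.mk (A.X.hom ≫ T.hom)
  let p : 𝔄 ⟶ T := Over.homMk A.X.hom rfl
  have hp₁ : p.left = A.X.hom := rfl
  let e𝔄 : pullback A.X.hom g₀ ≅ bc ℂ 𝔄 := pullbackRightPullbackFstIso T.hom (bcSpec K ℂ) A.X.hom
  have he₁ : e𝔄.hom ≫ pullback.fst 𝔄.hom (bcSpec K ℂ) = pullback.fst A.X.hom g₀ :=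
    pullbackRightPullbackFstIso_hom_fst _ _ _
  have he₂ : e𝔄.hom ≫ pullback.snd 𝔄.hom (bcSpec K ℂ) = pullback.snd A.X.hom g₀ ≫ pullback.snd T.hom (bcSpec K ℂ) :=
    pullbackRightPullbackFstIso_hom_snd _ _ _
  have hi₁ : e𝔄.inv ≫ pullback.fst A.X.hom g₀ = pullback.fst 𝔄.hom (bcSpec K ℂ) := by
    rw [← he₁, e𝔄.inv_hom_id_assoc]
  have hi₂ : e𝔄.inv ≫ pullback.snd A.X.hom g₀ ≫ pullback.snd T.hom (bcSpec K ℂ) = pullback.snd 𝔄.hom (bcSpec K ℂ) := by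
    rw [← he₂, e𝔄.inv_hom_id_assoc]
  haveI : IsReduced (bc ℂ 𝔄) := isReduced_of_isOpenImmersion e𝔄.inv
  haveI : IsSeparated 𝔄.hom := by
    change IsSeparated (A.X.hom ≫ T.hom)
    infer_instance
  have hr₂ : r.left ≫ pullback.snd A.X.hom g₀ = pullback.snd A.X.hom g₀ := Over.w r
  -- `galA` read on `𝔄_ℂ`
  have hge : ∀ σ : ℂ ≃ₐ[K] ℂ, e𝔄.hom ≫ gal ℂ 𝔄 σ = galA σ ≫ e𝔄.hom := by
    intro σ
    apply pullback.hom_ext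
    · rw [Category.assoc, Category.assoc, gal_fst, he₁]
      erw [hgal₁ σ]
    · rw [Category.assoc, Category.assoc, gal_snd, reassoc_of% he₂, he₂, reassoc_of% (hgal₂ σ), gal_snd]
  have hge' : ∀ σ : ℂ ≃ₐ[K] ℂ, gal ℂ 𝔄 σ ≫ e𝔄.inv = e𝔄.inv ≫ galA σ := by
    intro σ
    rw [← cancel_epi e𝔄.hom, reassoc_of% (hge σ), e𝔄.hom_inv_id, e𝔄.hom_inv_id_assoc, Category.comp_id]
  -- `r` transported to the complexified total space, as a `ℂ`-morphism
  have hw : (e𝔄.inv ≫ r.left ≫ e𝔄.hom) ≫ pullback.snd 𝔄.hom (bcSpec K ℂ) = pullback.snd 𝔄.hom (bcSpec K ℂ) := by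
    rw [Category.assoc, Category.assoc, he₂, reassoc_of% hr₂, hi₂]
  let r' : (bcFunctor K ℂ).obj 𝔄 ⟶ (bcFunctor K ℂ).obj 𝔄 := Over.homMk (e𝔄.inv ≫ r.left ≫ e𝔄.hom) hw
  have hr' : r'.left = e𝔄.inv ≫ r.left ≫ e𝔄.hom := rfl
  have hgal' : ∀ σ : ℂ ≃ₐ[K] ℂ, gal ℂ 𝔄 σ ≫ r'.left = r'.left ≫ gal ℂ 𝔄 σ := by
    intro σ
    rw [hr', reassoc_of% (hge' σ), Category.assoc, Category.assoc, hge σ, reassoc_of% (hr σ)]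
  -- Prop. 13.1 on the total space
  obtain ⟨f₀, hf₀, huniq⟩ := existsUnique_map_eq_complex (X := 𝔄) (Y := 𝔄) hK r' hgal'
  -- base change over `K` vs over `T`, through `e𝔄`
  have hnat : ∀ (f : 𝔄 ⟶ 𝔄) (hf : f.left ≫ A.X.hom = A.X.hom),
      ((Over.pullback g₀).map (Over.homMk f.left hf : A.X ⟶ A.X)).left ≫ e𝔄.hom =
        e𝔄.hom ≫ ((bcFunctor K ℂ).map f).left := by
    intro f hf
    apply pullback.hom_ext
    · rw [Category.assoc, Category.assoc, he₁, pullback_map_left_comp_fst', pullback_map_left_comp_fst',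
        reassoc_of% he₁]
      rfl
    · rw [Category.assoc, Category.assoc, he₂, pullback_map_left_comp_snd', he₂, ← Category.assoc,
        pullback_map_left_comp_snd']
  -- `f₀` lies over `T`
  have hp : ((bcFunctor K ℂ).map p).left = e𝔄.inv ≫ pullback.snd A.X.hom g₀ := by
    apply pullback.hom_ext
    · rw [pullback_map_left_comp_fst', Category.assoc, hp₁, ← hi₁, Category.assoc]
      congr 1
      exact pullback.condition
    · rw [pullback_map_left_comp_snd', Category.assoc, hi₂]
  have hf₀p : f₀ ≫ p = p := by
    apply bcFunctor_map_injective (L := ℂ)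
    rw [Functor.map_comp, hf₀]
    ext : 1
    rw [Over.comp_left, hp, hr', Category.assoc, Category.assoc, e𝔄.hom_inv_id_assoc, hr₂]
  have hf₀T : f₀.left ≫ A.X.hom = A.X.hom := by
    have h1 := congrArg Over.Hom.left hf₀p
    rw [Over.comp_left, hp₁] at h1
    exact h1
  -- the descended `T`-endomorphism
  refine ⟨Over.homMk f₀.left hf₀T, ?_, ?_⟩
  · ext : 1
    rw [← cancel_mono e𝔄.hom, hnat f₀ hf₀T, hf₀, hr', e𝔄.hom_inv_id_assoc]
  · intro e he
    let fe : 𝔄 ⟶ 𝔄 := Over.homMk e.left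
      (by change e.left ≫ A.X.hom ≫ T.hom = A.X.hom ≫ T.hom; rw [← Category.assoc, Over.w e])
    have hfe₁ : fe.left = e.left := rfl
    have h2 : (Over.homMk fe.left (Over.w e) : A.X ⟶ A.X) = e := by ext : 1; rfl
    have hfe : (bcFunctor K ℂ).map fe = r' := by
      ext : 1
      rw [← cancel_epi e𝔄.hom, ← hnat fe (Over.w e), h2, he, hr', e𝔄.hom_inv_id_assoc]
    have h3 := huniq fe hfe
    ext : 1
    change e.left = f₀.left
    rw [← hfe₁, h3]

omit [IsSeparated T.hom] [IsReduced (pullback A.X.hom (pullback.fst T.hom (bcSpec K ℂ)))] in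
/-- **The descended endomorphism is a homomorphism** when `r` is: unit compatibility descends through the faithfully flat `T_ℂ → T` (★
`one_baseChange_left_comp_fst`), and a unit-preserving endomorphism of an abelian scheme over a locally Noetherian base is a homomorphism (★
`isMonHom_of_one_comp_of_isLocallyNoetherian_base`). [cite: MumfordFogartyKirwan1994, Ch. 6 §1 Corollary 6.4 (p. 117)] -/
theorem isMonHom_of_pullback_map_eq_bcSpec [IsLocallyNoetherian T.left] [IsMonHom r] (e : A.X ⟶ A.X)
    (he : (Over.pullback (pullback.fst T.hom (bcSpec K ℂ))).map e = r) : IsMonHom e := by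
  let g₀ := pullback.fst T.hom (bcSpec K ℂ)
  haveI : Surjective (bcSpec K ℂ) := ⟨fun _ ↦ ⟨Classical.arbitrary _, Subsingleton.elim _ _⟩⟩
  haveI : Flat g₀ := MorphismProperty.pullback_fst _ _ inferInstance
  haveI : Surjective g₀ := MorphismProperty.pullback_fst _ _ inferInstance
  haveI : Epi g₀ := Flat.epi_of_flat_of_surjective _
  refine isMonHom_of_one_comp_of_isLocallyNoetherian_base e ?_
  have hfst : r.left ≫ pullback.fst A.X.hom g₀ = pullback.fst A.X.hom g₀ ≫ e.left := by
    have h0 := pullback_map_left_comp_fst' e g₀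
    rw [he] at h0
    exact h0
  have hηr : η[(A.baseChange g₀).X].left ≫ r.left = η[(A.baseChange g₀).X].left := by
    rw [← Over.comp_left, IsMonHom.one_hom]
  have hone : g₀ ≫ η[A.X].left = η[(A.baseChange g₀).X].left ≫ pullback.fst A.X.hom g₀ :=
    (A.one_baseChange_left_comp_fst g₀).symm
  ext : 1
  rw [Over.comp_left, ← cancel_epi g₀, reassoc_of% hone, ← hfst, reassoc_of% hηr, hone]

end Descent

/-! ## §4 THE HEAD: descent after a one-fibre-per-component check -/

section Head

variable (hK : #K ≤ ℵ₀) [IsSeparated T.hom] [IsLocallyNoetherian T.left] [IsLocallyNoetherian (bc ℂ T)]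
  [IsReduced (pullback A.X.hom (pullback.fst T.hom (bcSpec K ℂ)))] [IsMonHom r]

include hK hgal₁ hgal₂ in
/-- **AN ENDOMORPHISM OF `A_ℂ/T_ℂ` WHOSE GALOIS CONJUGATES AGREE WITH IT ON ONE FIBRE PER CONNECTED COMPONENT IS DEFINED OVER `K`.**
Let `K ⊆ ℂ` be countable, `T` a separated locally Noetherian `K`-scheme with `T_ℂ` locally Noetherian, `A → T` an abelian scheme with
`A ×_T T_ℂ` reduced, and `r : A_ℂ → A_ℂ` a homomorphism over `T_ℂ`.  If for every `σ ∈ Aut(ℂ/K)` and every point of `T_ℂ` some field-valued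
point of the same connected component has `r ∘ galA σ = galA σ ∘ r` on its fibre, then `r = e ×_T T_ℂ` for a UNIQUE homomorphism
`e : A → A` over `T` (§2 rigidity + §3 Prop. 13.1 + `isMonHom_of_pullback_map_eq_bcSpec`).
[cite: Milne2005ShimuraVarieties, §13 Prop. 13.1 p. 117 and Thm. 13.7 / Rem. 13.8 p. 119] [cite: MumfordFogartyKirwan1994, Ch. 6 §1 Corollary 6.2 (p. 116) and Corollary 6.4 (p. 117)] -/
theorem existsUnique_hom_pullback_map_eq_of_forall_exists_fieldPoint
    (h : ∀ (σ : ℂ ≃ₐ[K] ℂ) (x : ↥(bc ℂ T)), ∃ (L : Type) (_ : Field L) (s : Spec (.of L) ⟶ bc ℂ T),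
      s.base (IsLocalRing.closedPoint L) ∈ connectedComponent x ∧
        pullback.fst (pullback.snd A.X.hom (pullback.fst T.hom (bcSpec K ℂ))) s ≫ r.left ≫ galA σ =
          pullback.fst (pullback.snd A.X.hom (pullback.fst T.hom (bcSpec K ℂ))) s ≫ galA σ ≫ r.left) :
    ∃! e : A.X ⟶ A.X, IsMonHom e ∧ (Over.pullback (pullback.fst T.hom (bcSpec K ℂ))).map e = r := by
  have hr := A.forall_gal_comp_eq_of_forall_exists_fieldPoint galA hgal₁ hgal₂ r h
  obtain ⟨e, he, huniq⟩ := A.existsUnique_pullback_map_eq_of_forall_gal_comp galA hgal₁ hgal₂ r hK hr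
  exact ⟨e, ⟨A.isMonHom_of_pullback_map_eq_bcSpec r e he, he⟩, fun e' he' => huniq e' he'.2⟩

include hK in
/-- **The same for the CANONICAL Galois automorphisms `1 ×_T gal σ` of `A ×_T T_ℂ`** (the by-value clauses discharged by §1
`pullbackMap_gal_fst_snd`). [cite: Milne2005ShimuraVarieties, §13 Prop. 13.1 p. 117] [cite: MumfordFogartyKirwan1994, Ch. 6 §1 Corollary 6.2 (p. 116) and Corollary 6.4 (p. 117)] -/
theorem existsUnique_hom_pullback_map_eq_of_forall_exists_fieldPoint_pullbackMap
    (h : ∀ (σ : ℂ ≃ₐ[K] ℂ) (x : ↥(bc ℂ T)), ∃ (L : Type) (_ : Field L) (s : Spec (.of L) ⟶ bc ℂ T),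
      s.base (IsLocalRing.closedPoint L) ∈ connectedComponent x ∧
        pullback.fst (pullback.snd A.X.hom (pullback.fst T.hom (bcSpec K ℂ))) s ≫ r.left ≫
            pullback.map A.X.hom (pullback.fst T.hom (bcSpec K ℂ)) A.X.hom (pullback.fst T.hom (bcSpec K ℂ)) (𝟙 A.X.left)
              (gal ℂ T σ) (𝟙 T.left) (by rw [Category.comp_id, Category.id_comp]) (by rw [Category.comp_id, gal_fst]) =
          pullback.fst (pullback.snd A.X.hom (pullback.fst T.hom (bcSpec K ℂ))) s ≫
            pullback.map A.X.hom (pullback.fst T.hom (bcSpec K ℂ)) A.X.hom (pullback.fst T.hom (bcSpec K ℂ)) (𝟙 A.X.left)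
              (gal ℂ T σ) (𝟙 T.left) (by rw [Category.comp_id, Category.id_comp]) (by rw [Category.comp_id, gal_fst]) ≫ r.left) :
    ∃! e : A.X ⟶ A.X, IsMonHom e ∧ (Over.pullback (pullback.fst T.hom (bcSpec K ℂ))).map e = r :=
  A.existsUnique_hom_pullback_map_eq_of_forall_exists_fieldPoint _ (fun σ => (A.pullbackMap_gal_fst_snd σ).1)
    (fun σ => (A.pullbackMap_gal_fst_snd σ).2) r hK h

end Head

end AbelianSchemeOver

end Literature.AlgebraicGeometry.AbelianSchemes

end
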